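import Mathlib
import HarnessLib
import Summits.AtomisticToContinuum.FouriersLaw.Theses.FeketeSeriesLaw
import Summits.AtomisticToContinuum.FouriersLaw.Theses.SpatialCentreManifold

/-!
# `QuasiSubadditiveResistance` is the subadditive half of the affine resistance law
(stub for crux `JunctionLocality.SuperadditiveResistance`, stmt-AtomisticToContinuum-11748, line
floating-probe-bypass-laplacian, crux-position web; lead c7, 2026-08-17)

Route `SpatialCentreManifold` carries, along the weak-NESS shell of `pinnedChain ω₂ lam β γ`, the two-sided rate
statement `AffineResistanceLaw` (stmt-AtomisticToContinuum-13407):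
`∃ r > 0 ∀ family ∀ D ∃ C ∀ N, |R_N − (N−1)·r| ≤ C` with `R_N := (N−1)/D_N`.
Route `FeketeSeriesLaw` asks, over the SAME shell, for the series law with bounded junction defect
`QuasiSubadditiveResistance` (stmt-AtomisticToContinuum-14041): `∃ C ∀ N M ≥ 2, R_{N+M} ≤ R_N + R_M + C`.

This file records the elementary implication `AffineResistanceLaw → QuasiSubadditiveResistance`
(real analysis: `R_{N+M} ≤ (N+M−1)r + C`, `R_N ≥ (N−1)r − C`, `R_M ≥ (M−1)r − C` give
`R_{N+M} − R_N − R_M ≤ r + 3C`). Standard axioms; no named fact is taken.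
-/

noncomputable section

open MeasureTheory Filter Topology
open Literature.MathematicalPhysics.KineticTheory.HeatConduction

namespace Summit.AtomisticToContinuum.FouriersLaw.Cruxes.SuperadditiveResistance.CruxPosition

/-- **Real-analysis core.** If the resistances `R_N = (N−1)/D_N` stay within `C` of the affine law `(N−1)·r`
for all `N`, then the junction defect is bounded: `R_{N+M} ≤ R_N + R_M + (3C + r)` for `N, M ≥ 2`
(indeed `R_{N+M} ≤ (N+M−1)r + C = ((N−1)r − C) + ((M−1)r − C) + (r + 3C) ≤ R_N + R_M + (r + 3C)`). -/
theorem junctionDefectBounded_of_affine_bounds {D : ℕ → ℝ} {r C : ℝ}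
    (h : ∀ N : ℕ, |((N : ℝ) - 1) / D N - ((N : ℝ) - 1) * r| ≤ C) :
    ∃ C' : ℝ, ∀ N M : ℕ, 2 ≤ N → 2 ≤ M →
      ((N + M - 1 : ℕ) : ℝ) / D (N + M) ≤ ((N - 1 : ℕ) : ℝ) / D N + ((M - 1 : ℕ) : ℝ) / D M + C' := by
  refine ⟨3 * C + r, fun N M hN hM => ?_⟩
  have eN : ((N - 1 : ℕ) : ℝ) = (N : ℝ) - 1 := by
    rw [Nat.cast_sub (show 1 ≤ N by omega), Nat.cast_one]
  have eM : ((M - 1 : ℕ) : ℝ) = (M : ℝ) - 1 := by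
    rw [Nat.cast_sub (show 1 ≤ M by omega), Nat.cast_one]
  have eNM : ((N + M - 1 : ℕ) : ℝ) = (N : ℝ) + (M : ℝ) - 1 := by
    rw [Nat.cast_sub (show 1 ≤ N + M by omega), Nat.cast_add, Nat.cast_one]
  rw [eN, eM, eNM]
  have h1 := abs_le.mp (h N)
  have h2 := abs_le.mp (h M)
  have h3 := abs_le.mp (h (N + M))
  have hcast : ((N + M : ℕ) : ℝ) = (N : ℝ) + (M : ℝ) := by push_cast; ring
  rw [hcast] at h3
  obtain ⟨h1l, _⟩ := h1
  obtain ⟨h2l, _⟩ := h2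
  obtain ⟨_, h3u⟩ := h3
  linarith

/-- **`AffineResistanceLaw → QuasiSubadditiveResistance`.** Instantiate the affine law
(stmt-AtomisticToContinuum-13407) at the given parameters, uniqueness hypothesis and temperature, feed it the
given steady-state family and response coefficients, and apply `junctionDefectBounded_of_affine_bounds`. -/
theorem quasiSubadditiveResistance_of_affineResistanceLaw :
    Summit.AtomisticToContinuum.FouriersLaw.Theses.SpatialCentreManifold.AffineResistanceLaw →
      Summit.AtomisticToContinuum.FouriersLaw.Theses.FeketeSeriesLaw.QuasiSubadditiveResistance := by
  intro h ω₂ lam β γ hω hl hβ hγ hU μ hμ T hT D hD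
  obtain ⟨r, _hr, hfam⟩ := h ω₂ lam β γ hω hl hβ hγ hU T hT
  obtain ⟨C, hC⟩ := hfam μ hμ D hD
  exact junctionDefectBounded_of_affine_bounds hC

end Summit.AtomisticToContinuum.FouriersLaw.Cruxes.SuperadditiveResistance.CruxPosition

end
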